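import Literature.NumberTheory.Automorphic.AutomorphicFormsStableHolds
import Literature.NumberTheory.Automorphic.AutomorphyDatumGLRegular
import Literature.NumberTheory.Automorphic.AutomorphicFormsProofs
import HarnessLib

/-!
# Borel–Jacquet 4.3 for `GL_n` over a number field, unconditionally

Topic `NumberTheory/Automorphic`; sibling proof file of `AutomorphicForms` on the named fact
`automorphicForms_isStableSubmodule 𝒟` (Borel–Jacquet 1979, 4.3: the space `𝒜` of automorphic
forms of a regular automorphy datum is a `(𝔤, K_∞) × G(𝔸_f)`-module), at the honest datum
`AutomorphyDatum.gl n K hcpt` of `GL_n` over a number field `K` (`AdelicGLnGlue`).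

The general fact is discharged in the tree for every coefficient algebra whose involution is
`ℝ`-linear (`automorphicForms_isStableSubmodule_holds_of_starModule`, `AutomorphicFormsStableHolds`:
Harish-Chandra's growth lemma by interior elliptic regularity, on the elliptic annihilator of
`AutomorphicFormsEllipticAnnihilator` and the exponential charts of `ArchimedeanExpChart`). The
coefficient algebra of the `GL_n` datum is `K_∞ = K ⊗_ℚ ℝ ≅ ℝ^{r₁} × ℂ^{r₂}`
(`NumberField.mixedEmbedding.mixedSpace K`) with its standard, `ℝ`-linear, involution — exactly the
setting of the source — so the instance of the fact used by the `GL_n` theory and by the summit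
routes (`BorelJacquetDictionary`, first conjunct) holds outright:

* `automorphicForms_isStableSubmodule_gl hcpt : automorphicForms_isStableSubmodule (AutomorphyDatum.gl n K hcpt)`;
* `isStableSubmodule_automorphicForms_gl hcpt` — the same with the regularity hypothesis of the fact
  discharged as well (`AutomorphyDatum.isRegular_gl`, `AutomorphyDatumGLRegular`):
  `IsStableSubmodule (gl n K hcpt) (automorphicForms (gl n K hcpt))`;
* `IsAutomorphicForm.lieDeriv_gl` — in particular `X φ` is an automorphic form for every automorphic
  form `φ` on `GL_n(𝔸_K)` and every `X ∈ 𝔤𝔩_n(K_∞)` (Borel–Jacquet 1979, 4.3 with Harish-Chandra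
  1966, Lemma 13), superseding the conditional `GL_n` statements of `AutomorphicFormsStableGL`
  (`…_gl_of_HC`, `…_gl_of_finiteDimensional`) and `AutomorphicFormsStableFolland` (`…_gl_of_folland`).

Everything here is proved; no definitions, no named facts.

## References

* A. Borel, H. Jacquet, *Automorphic forms and automorphic representations*, Proc. Sympos. Pure
  Math. 33 (Corvallis 1977), Part 1 (1979), 189–202, 4.3 [BorelJacquetCorvallis1979].
* Harish-Chandra, *Discrete series for semisimple Lie groups II*, Acta Math. 116 (1966), §8,
  Lemma 13 [HarishChandra1966].
* A. Borel, *Automorphic forms on `SL₂(ℝ)`* (1997), 2.14, 5.6 [Borel1997].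
-/

noncomputable section

open scoped MatrixGroups Classical
open NumberField NumberField.mixedEmbedding

namespace Literature.NumberTheory.Automorphic

variable {n : ℕ} {K : Type} [Field K] [NumberField K]

/-- **Borel–Jacquet 1979, 4.3, for `GL_n` over a number field**: the instance
`automorphicForms_isStableSubmodule (AutomorphyDatum.gl n K hcpt)` of the named fact of
`AutomorphicForms` — the space of automorphic forms on `GL_n(𝔸_K)` is stable under right translation
by `GL_n(𝔸_K^∞)` and `K_∞` and under `𝔤𝔩_n(K_∞)` — holds unconditionally: the coefficient algebra
`K ⊗_ℚ ℝ = ℝ^{r₁} × ℂ^{r₂}` carries its standard `ℝ`-linear involution, so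
`automorphicForms_isStableSubmodule_holds_of_starModule` applies. Borel–Jacquet 1979, 4.3 (with
Harish-Chandra 1966, §8, Lemma 13 for the growth of `X φ`). [cite: BorelJacquetCorvallis1979, 4.3] -/
theorem automorphicForms_isStableSubmodule_gl (hcpt : isCompact_glFiniteIntegralLevel n K) :
    automorphicForms_isStableSubmodule (AutomorphyDatum.gl n K hcpt) :=
  automorphicForms_isStableSubmodule_holds_of_starModule

/-- **The space of automorphic forms on `GL_n(𝔸_K)` is a `(𝔤, K_∞) × GL_n(𝔸_K^∞)`-module**, with
both hypotheses of the named fact discharged (`K ⊗_ℚ ℝ` is finite-dimensional over `ℝ`, and the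
`GL_n` datum is regular, `AutomorphyDatum.isRegular_gl`). Borel–Jacquet 1979, 4.3. [cite: BorelJacquetCorvallis1979, 4.3] -/
theorem isStableSubmodule_automorphicForms_gl (hcpt : isCompact_glFiniteIntegralLevel n K) :
    IsStableSubmodule (AutomorphyDatum.gl n K hcpt) (automorphicForms (AutomorphyDatum.gl n K hcpt)) :=
  automorphicForms_isStableSubmodule_gl hcpt (AutomorphyDatum.isRegular_gl hcpt)

/-- **Lie derivatives of automorphic forms on `GL_n(𝔸_K)` are automorphic forms**: for `φ`
automorphic and `X ∈ 𝔤𝔩_n(K_∞)`, `X φ` is an automorphic form (smooth, `K_∞`-finite, `Z(𝔤)`-finite,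
of moderate growth — the last by Harish-Chandra's growth lemma). Borel–Jacquet 1979, 4.3;
Harish-Chandra 1966, §8, Lemma 13; Borel 1997, 2.14 / 5.6. [cite: BorelJacquetCorvallis1979, 4.3] -/
theorem IsAutomorphicForm.lieDeriv_gl {hcpt : isCompact_glFiniteIntegralLevel n K}
    {φ : (AdelicGroupData.gl n K).Adelic → ℂ} (hφ : IsAutomorphicForm (AutomorphyDatum.gl n K hcpt) φ)
    (X : (AutomorphyDatum.gl n K hcpt).arch.lie) :
    IsAutomorphicForm (AutomorphyDatum.gl n K hcpt) (lieDeriv (AutomorphyDatum.gl n K hcpt).ofArch X φ) := by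
  have hreg := AutomorphyDatum.isRegular_gl hcpt
  have hmem := (isStableSubmodule_automorphicForms_gl hcpt).lie_stable X φ hφ.mem_automorphicForms
  exact (mem_automorphicForms_iff_holds hreg.directedOn_finiteLevels _).1 hmem

/-- **Right translates of automorphic forms on `GL_n(𝔸_K)` by `GL_n(𝔸_K^∞)` stay in `𝒜`** (the
`G(𝔸_f)`-part of Borel–Jacquet 4.3 at the `GL_n` datum, read off the stable-submodule structure).
Borel–Jacquet 1979, 4.3. [cite: BorelJacquetCorvallis1979, 4.3] -/
theorem automorphicForms_gl_le_comap_rightTranslation {hcpt : isCompact_glFiniteIntegralLevel n K}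
    {h : (AdelicGroupData.gl n K).Adelic} (hh : h ∈ (AutomorphyDatum.gl n K hcpt).finiteAdelic) :
    automorphicForms (AutomorphyDatum.gl n K hcpt) ≤
      (automorphicForms (AutomorphyDatum.gl n K hcpt)).comap (rightTranslation (AdelicGroupData.gl n K) h) :=
  (isStableSubmodule_automorphicForms_gl hcpt).finite_stable h hh

end Literature.NumberTheory.Automorphic
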